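import Mathlib
import Summits.AtomisticToContinuum.HydrodynamicLimit.Theorems.ImplosionDichotomyDenseExcursionSonicCavityDefsC

/-!
# Vocabulary of the line `sonic-cavity-renewal`, part D (skeleton reshape v8 of crux `DenseExcursion`,
# stmt-AtomisticToContinuum-12586): the LOOP CLAUSE of the tube — the certified data of the closed-contour slaving proof

Definitions file (`--supports stmt-AtomisticToContinuum-12586`, line lead a2; the clause text is the wave-3 worker A's proposal
`work/stubs/A3/CavityTubeLoop_proposal.lean` VERBATIM, generated from the same templates as the landed theorem
`sonicSlaving_of_wedgeLoop` (`…SonicSlavingContour`, p161760), so that `stub_sonicSlaving` (v8) is a three-line bridge).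

WHY A PART D. Wave 3 landed the whole contour-transport architecture of sonic slaving (Literature `HolomorphicLinearODEStarConvex`
p155712, `LoopSlavingEstimate` p157822, `SmoothstepPolygon` p159038; `smoothMode_wedge_continuation` p157862; the twelve-edge contour
`exists_sonicLoop` p160721; the assembly p161760): the slaved gauge of a smooth radial mode is transported around a CLOSED loop through the
matching point `x_m = −7/10` and around the sonic point inside `sonicWedge`; single-valuedness of the holomorphic mode closes the loop,
the first (downward) leg gains `e^{−1598·η_m·…}`, and the Literature loop estimate gives `|Im Λ|‖D‖ ≤ (1/90)‖m‖` against the registered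
`2`. What `CavityTubeWedge` (part C) cannot supply, with numbers (`A_sonicSlaving.REPORT.md` §2): the SIGN of the transport exponent on the
wedge rays (a monotonicity property `|t|(1/c₊ + 1/|c₋|)↑` of the profile, true on `SS(r₂)` 1.29 → 2.43, not implied by sup-norm bounds),
the 10 % pin of `Re(1/c₊ − 1/c₋)` on the vertical segment at `x_m`, and coupling/forcing budgets within a factor ≈ 4 of the truth for the
a-priori closure (crude wedge constants lose ≈ 240×). DATA: `CavityTubeLoop r Wc Sc` — (L) nine sup bounds on the closed sub-wedge
`{−7/10 ≤ Re z ≤ 0, |Im z| ≤ (27/200)|Re z|} ∪ {‖z‖ ≤ 9/200}`, (V) three inequalities on the vertical segment `z = −7/10 + iη`,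
`|η| ≤ 189/2000`, (E) the tangent triple on the twelve edges of the explicit contour — every numeral validated on `SS(r₂)` by continuing
the profile ODE off the axis (`clause_check.py`, `clause_check2.py`; smallest relative slack 20 %; true values in the docstring of
`CavityTubeLoop`). `CavityTubeWedgeLoop r W S` = the conjuncts of `CavityTubeWedge` verbatim ∧ the loop clause for the SAME continuation.
Certifiable by Taylor models of the BCG profile in `ℂ` along 12 explicit segments and on the sub-wedge. NOT here: any proof of a stub.
-/

noncomputable section

namespace Summit.AtomisticToContinuum.HydrodynamicLimit.Theorems.SonicCavityRenewal

open Summit.AtomisticToContinuum.HydrodynamicLimit.Theorems.R2OneModeTwoConditions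

/-- THE LOOP CLAUSE (g′) OF THE TUBE (v8): certified inequalities about the holomorphic continuation `Wc, Sc` of the pinned
profile along the closed contour of the sonic-slaving proof and on the closed sub-wedge containing it. Notation (all complex, at a point
`z`): `c± = Wc z − 1 ± Sc z`, `b₊₊ = ⅔Wc′ + 2Wc − r + 2Sc′ + 4Sc`, `b₋₋ = ⅔Wc′ + 2Wc − r − 2Sc′ − 4Sc`, `b₊₋ = Wc′/3 + Sc′ + 2Sc`,
`b₋₊ = Wc′/3 − Sc′ − 2Sc`, `k₁ = c₊/c₋`, `k₁′ = (Wc′ + Sc′)/c₋ − c₊(Wc′ − Sc′)/c₋²`, `h = 1/c₊ − 1/c₋`; for a tangent vector `τ`: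
`D₁ = −Im(τh)`, `D₂ = Re(τh)`, `D₃ = Re(−b₊₊τ/c₊ + b₋₋τ/c₋)`.
(L) on `{−7/10 ≤ Re z ≤ 0, |Im z| ≤ (27/200)|Re z|} ∪ {‖z‖ ≤ 9/200}`: `‖b₋₊/c₋‖ ≤ 4/5`, `‖b₊₋‖ ≤ 2`, `‖b₊₋′‖ ≤ 2`, `‖k₁‖ ≤ 9/25`,
`‖k₁′‖ ≤ 3/5`, `‖b₊₊‖ ≤ 3`, `‖b₋₋‖ ≤ 5`, `‖b₊₊′‖ ≤ 4`, `‖b₋₋′‖ ≤ 4` (true maxima on `SS(r₂)`: 0.651, 1.611, 1.487, 0.287, 0.447, 2.353,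
4.061, 2.935, 3.082);
(V) on the vertical segment `z = −7/10 + ηi`, `|η| ≤ 189/2000`: `Re h ≥ 8/5`, `|Im h| ≤ 2/5`, `|Im(b₊₊/c₊ − b₋₋/c₋)| ≤ 2/5` (true:
1.799, 0.315, 0.313);
(E) on the twelve edges `[A_k, A_{k+1}]` of the contour (vertices below) with tangent `τ = A_{k+1} − A_k`: `D₁ ≥ 0`,
`1000 D₁ − D₂/4 + D₃ ≥ 1`, `1000 D₁ + 3D₂ + D₃ ≥ 1` (true minima: `D₁`: 0.170, 0.048, 1.29–1.73 (octagon), 0.048, 0.170; the two corner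
combinations: 170, 46–50, 1292–1729, 45–49, 170). Since the transport exponent is `Im Λ·D₁ + Re Λ·D₂ + D₃ − Re(αρτ)` (affine in `Λ`),
(E) makes it `≥ 0` along the whole contour for every rate with `Im Λ ≥ 1000`, `−1/4 ≤ Re Λ ≤ 3`, and (V) makes it `≥ 1598` per unit
depth on the first leg. Vertices: `A₀ = −7/10`, `A₁ = −7/10 − (189/2000)i`, `A₂ = −1/25 − (27/5000)i`, `A₃ = −3/100 − (3/100)i`,
`A₄ = −(1/25)i`, `A₅ = 3/100 − (3/100)i`, `A₆ = 1/25`, `A₇ = 3/100 + (3/100)i`, `A₈ = (1/25)i`, `A₉ = −3/100 + (3/100)i`,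
`A₁₀ = −1/25 + (27/5000)i`, `A₁₁ = −7/10 + (189/2000)i`, `A₁₂ = −7/10`. -/
def CavityTubeLoop (r : ℝ) (Wc Sc : ℂ → ℂ) : Prop :=
  (∀ z : ℂ, ((-(7 / 10 : ℝ) ≤ z.re ∧ z.re ≤ 0 ∧ |z.im| ≤ 27 / 200 * |z.re|) ∨ ‖z‖ ≤ 9 / 200) → (‖(deriv Wc z / 3 - deriv Sc z - 2 * Sc z) / (Wc z - 1 - Sc z)‖ ≤ 4 / 5 ∧ ‖(deriv Wc z / 3 + deriv Sc z + 2 * Sc z)‖ ≤ 2 ∧ ‖(deriv (deriv Wc) z / 3 + deriv (deriv Sc) z + 2 * deriv Sc z)‖ ≤ 2 ∧ ‖((Wc z - 1 + Sc z) / (Wc z - 1 - Sc z))‖ ≤ 9 / 25 ∧ ‖((deriv Wc z + deriv Sc z) / (Wc z - 1 - Sc z) - (Wc z - 1 + Sc z) * (deriv Wc z - deriv Sc z) / (Wc z - 1 - Sc z) ^ 2)‖ ≤ 3 / 5 ∧ ‖(2 / 3 * deriv Wc z + 2 * Wc z - r + 2 * deriv Sc z + 4 * Sc z)‖ ≤ 3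 ∧ ‖(2 / 3 * deriv Wc z + 2 * Wc z - r - 2 * deriv Sc z - 4 * Sc z)‖ ≤ 5 ∧ ‖(2 / 3 * deriv (deriv Wc) z + 2 * deriv Wc z + 2 * deriv (deriv Sc) z + 4 * deriv Sc z)‖ ≤ 4 ∧ ‖(2 / 3 * deriv (deriv Wc) z + 2 * deriv Wc z - 2 * deriv (deriv Sc) z - 4 * deriv Sc z)‖ ≤ 4)) ∧
  (∀ η : ℝ, |η| ≤ 189 / 2000 → 8 / 5 ≤ ((1 / (Wc (((-(7 / 10 : ℝ)) : ℂ) + (η : ℂ) * Complex.I) - 1 + Sc (((-(7 / 10 : ℝ)) : ℂ) + (η : ℂ) * Complex.I)) - 1 / (Wc (((-(7 / 10 : ℝ)) : ℂ) + (η : ℂ) * Complex.I) - 1 - Sc (((-(7 / 10 : ℝ)) : ℂ) + (η : ℂ) * Complex.I)))).re ∧ |((1 / (Wc (((-(7 / 10 : ℝ)) : ℂ) + (η : ℂ) * Complex.I) - 1 + Sc (((-(7 / 10 : ℝ)) : ℂ) + (η : ℂ) * Complex.I)) - 1 / (Wc (((-(7 / 10 : ℝ)) : ℂ) + (η : ℂ)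 * Complex.I) - 1 - Sc (((-(7 / 10 : ℝ)) : ℂ) + (η : ℂ) * Complex.I)))).im| ≤ 2 / 5 ∧ |((2 / 3 * deriv Wc (((-(7 / 10 : ℝ)) : ℂ) + (η : ℂ) * Complex.I) + 2 * Wc (((-(7 / 10 : ℝ)) : ℂ) + (η : ℂ) * Complex.I) - r + 2 * deriv Sc (((-(7 / 10 : ℝ)) : ℂ) + (η : ℂ) * Complex.I) + 4 * Sc (((-(7 / 10 : ℝ)) : ℂ) + (η : ℂ) * Complex.I)) / (Wc (((-(7 / 10 : ℝ)) : ℂ) + (η : ℂ) * Complex.I) - 1 + Sc (((-(7 / 10 : ℝ)) : ℂ) + (η : ℂ) * Complex.I)) - (2 / 3 * deriv Wc (((-(7 / 10 : ℝ)) : ℂ) + (η : ℂ) * Complex.I) + 2 * Wc (((-(7 / 10 : ℝ)) : ℂ) + (η : ℂ) * Complex.I) - r - 2 * deriv Sc (((-(7 / 10 : ℝ)) : ℂ) + (η : ℂ) * Complex.I) - 4 * Sc (((-(7 / 10 : ℝ)) : ℂ) + (η : ℂ) * Complex.I)) / (Wc (((-(7 / 10 : ℝ)) : ℂ) + (η :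 ℂ) * Complex.I) - 1 - Sc (((-(7 / 10 : ℝ)) : ℂ) + (η : ℂ) * Complex.I))).im| ≤ 2 / 5) ∧
  (∀ A : Fin 13 → ℂ, A = ![((-(7 / 10 : ℝ)) : ℂ), ((-(7 / 10 : ℝ)) : ℂ) - (189 / 2000 : ℝ) * Complex.I, ((-(1 / 25 : ℝ)) : ℂ) - (27 / 5000 : ℝ) * Complex.I, ((-(3 / 100 : ℝ)) : ℂ) - (3 / 100 : ℝ) * Complex.I, -((1 / 25 : ℝ) : ℂ) * Complex.I, ((3 / 100 : ℝ) : ℂ) - (3 / 100 : ℝ) * Complex.I, ((1 / 25 : ℝ) : ℂ), ((3 / 100 : ℝ) : ℂ) + (3 / 100 : ℝ) * Complex.I, ((1 / 25 : ℝ) : ℂ) * Complex.I, ((-(3 / 100 : ℝ)) : ℂ) + (3 / 100 : ℝ) * Complex.I, ((-(1 / 25 : ℝ)) : ℂ) + (27 / 5000 : ℝ) * Complex.I, ((-(7 / 10 : ℝ)) : ℂ) + (189 / 2000 : ℝ) * Complex.I, ((-(7 / 10 : ℝ)) : ℂ)] → (∀ k : Fin 12, ∀ s : ℝ, 0 ≤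 s → s ≤ 1 → (0 ≤ (-(((A k.succ - A k.castSucc)) * (1 / (Wc (A k.castSucc + (s : ℂ) * (A k.succ - A k.castSucc)) - 1 + Sc (A k.castSucc + (s : ℂ) * (A k.succ - A k.castSucc))) - 1 / (Wc (A k.castSucc + (s : ℂ) * (A k.succ - A k.castSucc)) - 1 - Sc (A k.castSucc + (s : ℂ) * (A k.succ - A k.castSucc))))).im) ∧ 1 ≤ 1000 * (-(((A k.succ - A k.castSucc)) * (1 / (Wc (A k.castSucc + (s : ℂ) * (A k.succ - A k.castSucc)) - 1 + Sc (A k.castSucc + (s : ℂ) * (A k.succ - A k.castSucc))) - 1 / (Wc (A k.castSucc + (s : ℂ) * (A k.succ - A k.castSucc)) - 1 - Sc (A k.castSucc + (s : ℂ) * (A k.succ - A k.castSucc))))).im) - ((((A k.succ - A k.castSucc)) * (1 / (Wc (A k.castSucc + (s : ℂ) * (A k.succ - A k.castSucc)) - 1 + Sc (A k.castSucc + (s : ℂ) * (A k.succ - A k.castSucc))) - 1 / (Wc (A k.castSucc + (s : ℂ) * (A k.succ - A k.castSucc)) - 1 - Sc (A k.castSucc + (s : ℂ) * (A k.succ - A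 k.castSucc))))).re) / 4 + ((-((2 / 3 * deriv Wc (A k.castSucc + (s : ℂ) * (A k.succ - A k.castSucc)) + 2 * Wc (A k.castSucc + (s : ℂ) * (A k.succ - A k.castSucc)) - r + 2 * deriv Sc (A k.castSucc + (s : ℂ) * (A k.succ - A k.castSucc)) + 4 * Sc (A k.castSucc + (s : ℂ) * (A k.succ - A k.castSucc))) * ((A k.succ - A k.castSucc)) / (Wc (A k.castSucc + (s : ℂ) * (A k.succ - A k.castSucc)) - 1 + Sc (A k.castSucc + (s : ℂ) * (A k.succ - A k.castSucc)))) + (2 / 3 * deriv Wc (A k.castSucc + (s : ℂ) * (A k.succ - A k.castSucc)) + 2 * Wc (A k.castSucc + (s : ℂ) * (A k.succ - A k.castSucc)) - r - 2 * deriv Sc (A k.castSucc + (s : ℂ) * (A k.succ - A k.castSucc)) - 4 * Sc (A k.castSucc + (s : ℂ) * (A k.succ - A k.castSucc))) * ((A k.succ - A k.castSucc)) / (Wc (A k.castSucc + (s : ℂ) * (A k.succ - A k.castSucc)) - 1 - Sc (A k.castSucc + (s : ℂ) * (A k.succ - A k.castSucc)))).re) ∧ 1 ≤ 1000 * (-(((A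 k.succ - A k.castSucc)) * (1 / (Wc (A k.castSucc + (s : ℂ) * (A k.succ - A k.castSucc)) - 1 + Sc (A k.castSucc + (s : ℂ) * (A k.succ - A k.castSucc))) - 1 / (Wc (A k.castSucc + (s : ℂ) * (A k.succ - A k.castSucc)) - 1 - Sc (A k.castSucc + (s : ℂ) * (A k.succ - A k.castSucc))))).im) + 3 * ((((A k.succ - A k.castSucc)) * (1 / (Wc (A k.castSucc + (s : ℂ) * (A k.succ - A k.castSucc)) - 1 + Sc (A k.castSucc + (s : ℂ) * (A k.succ - A k.castSucc))) - 1 / (Wc (A k.castSucc + (s : ℂ) * (A k.succ - A k.castSucc)) - 1 - Sc (A k.castSucc + (s : ℂ) * (A k.succ - A k.castSucc))))).re) + ((-((2 / 3 * deriv Wc (A k.castSucc + (s : ℂ) * (A k.succ - A k.castSucc)) + 2 * Wc (A k.castSucc + (s : ℂ) * (A k.succ - A k.castSucc)) - r + 2 * deriv Sc (A k.castSucc + (s : ℂ) * (A k.succ - A k.castSucc)) + 4 * Sc (A k.castSucc + (s : ℂ) * (A k.succ - A k.castSucc))) * ((A k.succ - A k.castSucc)) / (Wc (A k.castSucc + (s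 : ℂ) * (A k.succ - A k.castSucc)) - 1 + Sc (A k.castSucc + (s : ℂ) * (A k.succ - A k.castSucc)))) + (2 / 3 * deriv Wc (A k.castSucc + (s : ℂ) * (A k.succ - A k.castSucc)) + 2 * Wc (A k.castSucc + (s : ℂ) * (A k.succ - A k.castSucc)) - r - 2 * deriv Sc (A k.castSucc + (s : ℂ) * (A k.succ - A k.castSucc)) - 4 * Sc (A k.castSucc + (s : ℂ) * (A k.succ - A k.castSucc))) * ((A k.succ - A k.castSucc)) / (Wc (A k.castSucc + (s : ℂ) * (A k.succ - A k.castSucc)) - 1 - Sc (A k.castSucc + (s : ℂ) * (A k.succ - A k.castSucc)))).re))))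

/-- THE WEDGE-AND-LOOP CLAUSE (v8 hypothesis of `stub_sonicSlaving`, `stub_cavityResolventCk`, `stub_packingResolventW`, replacing part C's `CavityTubeWedge W S`): the conjuncts of
`CavityTubeWedge` VERBATIM and the loop clause, for the SAME continuation `Wc, Sc`. -/
def CavityTubeWedgeLoop (r : ℝ) (W S : ℝ → ℝ) : Prop :=
  ∃ Wc Sc : ℂ → ℂ, DifferentiableOn ℂ Wc sonicWedge ∧ DifferentiableOn ℂ Sc sonicWedge ∧
    (∀ x : ℝ, -(4 / 5 : ℝ) < x → x < 1 / 20 → Wc x = W x ∧ Sc x = S x) ∧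
    (∀ z ∈ sonicWedge, ‖Wc z‖ ≤ 1 / 4 ∧ ‖Sc z‖ ≤ 5 / 2 ∧ ‖deriv Wc z‖ ≤ 1 / 2 ∧ ‖deriv Sc z‖ ≤ 5 / 2 ∧
      ‖deriv (deriv Wc) z‖ ≤ 2 ∧ ‖deriv (deriv Sc) z‖ ≤ 3) ∧
    (∀ z ∈ sonicWedge, 1 ≤ ‖Wc z - 1 - Sc z‖) ∧
    (∀ z ∈ sonicWedge, 3 / 10 * ‖z‖ ≤ ‖Wc z - 1 + Sc z‖) ∧
    (∀ z ∈ sonicWedge, z ≠ 0 → |((Wc z - 1 + Sc z) / (-z)).im| ≤ 1 / 5 * ((Wc z - 1 + Sc z) / (-z)).re) ∧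
    CavityTubeLoop r Wc Sc

/-- The wedge-and-loop clause contains part C's wedge clause (registered sub-goal `cavityTubeWedge_of_wedgeLoop` of
stmt-AtomisticToContinuum-12586). [folklore] -/
theorem cavityTubeWedge_of_wedgeLoop : ∀ (r : ℝ) (W S : ℝ → ℝ), CavityTubeWedgeLoop r W S → CavityTubeWedge W S := by
  intro r W S h
  obtain ⟨Wc, Sc, h1, h2, h3, h4, h5, h6, h7, -⟩ := h
  exact ⟨Wc, Sc, h1, h2, h3, h4, h5, h6, h7⟩

end Summit.AtomisticToContinuum.HydrodynamicLimit.Theorems.SonicCavityRenewal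

end
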